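/-
COR-CM (cell pub-hodgecm2 = stage 2 of the Hodge ladder), seat b17 gen 17 (prover-pub-hodgecm2-b17-g17-0, 2026-08-21),
display corollary F3 of RULING F3 (lead gen 5, 2026-08-21T03:40:19Z): the closed display `hc_cm_closed` (F2, RULING
E-DISPLAY) with its last geometric datum `h₁` instantiated by the tree theorem `BallQuotient.ballQuotientUniformised_holds`.
Theorems only: no definition, no named fact, no instance; no new constant of type `HC_CM_of_PerLFace` (RULING E-DEDUP);
`Assembly/ModelChainClosed.lean`, `Assembly/ModelChain.lean`, `Interfaces.lean` untouched (C1).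
-/
import Summits.HodgeConjecture.CorCM.Assembly.ModelChainClosed
import Summits.HodgeConjecture.CorCM.Geometry.BallQuotientUniformisedHolds
import HarnessLib

/-!
# The COR-CM E term, closed: `HC_CM` from `PerLFace` on the model universe of record alone

The stage-2 E term of record `hc_cm_of_PerLFace : HC_CM_of_PerLFace` (`CorCM/Assembly/ModelChain.lean`) reads
`∀ hHD hI h₁ h₃, U.PerLFace → DeligneMilne1982_Thm_6_20_full → HC_CM` for the model universe
`U = Model.picardCMUniverse hHD hI h₁ h₃`; its display `hc_cm_closed (h₁) (hP) : HC_CM`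
(`CorCM/Assembly/ModelChainClosed.lean`) instantiates `hHD`, `hI`, `h₃`, `hR` by tree theorems.  The remaining
geometric datum is now a tree theorem as well: `h₁ = PicardCM.BallQuotientUniformised` — compact torsion-free
arithmetic quotients of the complex 2-ball are smooth projective surfaces, holomorphically uniformised by the ball —
is `BallQuotient.ballQuotientUniformised_holds` (`CorCM/Geometry/BallQuotientUniformisedHolds.lean`:
`ballQuotientUniformised_of_embedding compactBallQuotient_projectiveEmbedding_holds`, i.e. cocompactness
(Borel–Harish-Chandra / Godement), the projective embedding of compact free ball quotients (Shafarevich IX §3.2;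
Kodaira), Chow and GAGA — all kernel theorems upstream).  This file records the fully instantiated form: **the Hodge
conjecture for every complex abelian variety of CM type (`HC_CM`, BY NAME
`Summit.HodgeConjecture.HodgeConjecture.Theses.RankFourFaces.CMAbelianHodge`) follows in the kernel from the
face-form period theorem `PerLFace` on the model universe of record
`Model.picardCMUniverse exists_isReal_hodgeModel_holds hodgePQ_independent_of_hodgeModel_holds
BallQuotient.ballQuotientUniformised_holds cmAbelianVarietyRealised_holds`** — displayed leaf `{PerLFace}`.

## References
* [Shimura1998] G. Shimura, *Abelian Varieties with Complex Multiplication and Modular Functions* (1998), §6.2 Thm. 3.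
* [DeligneMilne1982Tannakian] P. Deligne, J. S. Milne, *Tannakian Categories*, LNM 900 (1982), §6 Thm. 6.20.
* [Shafarevich1994] I. R. Shafarevich, *Basic Algebraic Geometry 2* (1994; 3rd ed. 2013), Book 3, Chap. IX §3.2.
-/

noncomputable section

namespace Summit.HodgeConjecture.CorCM

open Literature.NumberTheory.Automorphic.PicardCM
open Literature.AlgebraicGeometry.HodgeTheory

/-- **`HC_CM` from `PerLFace` alone** — the E term `hc_cm_of_PerLFace` at the kernel leaves
`hHD ✓ (exists_isReal_hodgeModel_holds), hI ✓ (hodgePQ_independent_of_hodgeModel_holds),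
h₁ ✓ (BallQuotient.ballQuotientUniformised_holds), h₃ ✓ (cmAbelianVarietyRealised_holds),
hR ✓ (deligneMilne1982_Thm_6_20_full_holds)`: the face-form period theorem `PerLFace` on the model universe of
record, all four of whose data are theorems of the tree, implies the Hodge conjecture for every complex abelian
variety of CM type; displayed leaf `{PerLFace}`.
[cite: Shimura1998, §6.2 Theorem 3 (pp. 41–42)] [cite: DeligneMilne1982Tannakian, §6 Thm. 6.20 (Riemann), p. 212]
[cite: Shafarevich1994, Book 3 Chap. IX §3.2 (Projective Embedding), Theorem and Remark] -/
theorem hc_cm_closed_of_perLFace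
    (hP : (Model.picardCMUniverse exists_isReal_hodgeModel_holds hodgePQ_independent_of_hodgeModel_holds
      BallQuotient.ballQuotientUniformised_holds cmAbelianVarietyRealised_holds).PerLFace) : HC_CM :=
  hc_cm_closed BallQuotient.ballQuotientUniformised_holds hP

end Summit.HodgeConjecture.CorCM

end
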